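import Summits.HodgeConjecture.HodgeConjecture.Theorems.VHCAbelianSchemesRoadIsogenyPushforwardAdmissibilityTransfer
import Summits.HodgeConjecture.HodgeConjecture.Theorems.VHCAbelianSchemesRoadSigmaTransferDerivedLiftingDatum
import Literature.AlgebraicGeometry.Crystalline.HodgeSheavesTorsionFree
import Literature.AlgebraicGeometry.Modules.SheafHomFrames
import Literature.AlgebraicGeometry.Motives.AbelianVarietyProofs
import HarnessLib

/-!
# Road №4 (`VHCAbelianSchemesRoad`) — core (SC) `IsogenyPushforwardISemiregularCTransfer` of THEOREM T (crux
# stmt-HodgeConjecture-26512) as a KERNEL COMPOSITION of three displayed push-forward compatibilities over a DERIVED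
# DIRECT IMAGE DATUM (the infrastructure node (L7a))

research route conditional on HC_CM; not a corollary; Q11.4-sentence-2 already refuted in dim ≥ 3.

core-SC gen 0 (director-hodge g14 R14.24 «the hard step's four pieces get provers on ALL FOUR», plate (SC); LEAD 163 BOOKED
l.5521). `--supports stmt-HodgeConjecture-26512 --as helper`; closes NO stub or item: the main theorem is CONDITIONAL on two
displayed DATA ((L7a), (L7b)) and three displayed compatibilities ((At), (Tr), (Ext)); nothing here says (SC), (c1), THEOREM T,
26511 ∕ 26512 ∕ 23176, `HC_AV`, `HC_CM` or HC holds; HC_CM HELD, by name only; typed ≠ proved.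

THE CORE. (SC) `IsogenyPushforwardISemiregularCTransfer` (p638304 §3): for an isogeny `g` of a complex abelian variety `A`, a complex
`E•` in `[a, b]` with vector-bundle terms (and `g_*•E•` termwise a vector bundle) and (C^∨) for `(g, E•)`, Buchweitz–Flenner joint
injectivity of `(σ_q)_{q ∈ J}` on `Ext²` holds for `g_*•E•` iff it holds for `E•` (the venture's `HomComplex.IsISemiregularC` on real
carriers in `D(Mod 𝒪_A)`). The tree transports `σ_q` along ISOMORPHISMS of schemes only (`HomComplex.IsISemiregularC.of_schemeIso`,
pieces (N1)–(N5)), and all five pieces ride on ONE vehicle: `e_{**} = mapShiftedHom (pushforward e.hom.left)`, the action on shifted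
Homs of Mathlib's `Functor.mapDerivedCategory` of an EXACT functor.

WHY THE VEHICLE DIES FOR `deg g ≥ 2` (scoping memo `SCOPING-MEMO-SC-core-sc-g0.md`, evidence #23 on 26512). For an isogeny `g` of
degree `≥ 2`, `Scheme.Modules.pushforward g` is NOT right exact on `Mod 𝒪_A` (ALL modules, Zariski topology): for closed points
`x₁ ≠ x₂` of one fibre `g⁻¹(y)` and `U = A ∖ {x₂}`, the epimorphism `j_!𝒪_U ↠ k(x₁)` has `(g_*j_!𝒪_U)_y = colim_{V ⊇ g⁻¹(y)} Γ(V, j_!𝒪_U) = 0`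
(`A` integral: a non-zero section over `V ∩ U` has support `V ∩ U`, closed in `V` iff `x₂ ∉ V`) but `(g_*k(x₁))_y = k(x₁) ≠ 0`. So
`PreservesFiniteColimits (pushforward g)` is FALSE (a theorem displaying that instance would be vacuous), `(pushforward g).mapDerivedCategory`
does not exist, and `g_{**}` cannot be typed on the tree's carriers. The honest vehicle is the right-derived direct image `Rg_*` on
`D(Mod 𝒪_A)` with `Rg_*(Q K•) ≅ Q(g_*•K•)` on bounded complexes of vector bundles (`g` affine: quasi-coherent terms are `g_*`-acyclic) —
not constructible in the tree today (Mathlib: `Functor.rightDerivedFunctorPlus`, on `DerivedCategory.Plus`, needs `EnoughInjectives`, not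
yet triangulated). It enters below as the DATUM (L7a).

WHAT IS PROVED (sorry-free; every non-proved input DISPLAYED). The generic plumbing — the ABSTRACT TRANSFER
`isISemiregularC_iff_of_sigmaCompat` (for `Ψ` on `Ext²` and `ρ_q` on the `σ`-targets with `σ'_q ∘ Ψ = ρ_q ∘ σ_q`: `Ψ` bijective and `ρ_q`
injective give `IsISemiregularC K' ↔ IsISemiregularC K`), the tail `sigmaTail` of `σ_q`, and DERIVED LIFTING DATA `DerivedLiftingDatum G P`
with their multiplicative action `G_{**} = DerivedLiftingDatum.mapShiftedHom` — is the companion file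
`VHCAbelianSchemesRoadSigmaTransferDerivedLiftingDatum.lean` (same seat). Here:
* §3 **(L7a) `IsogenyDerivedDirectImage A g := DerivedLiftingDatum (g_*•) IsBoundedVBComplex`** in `D(Mod 𝒪_A)` (`HasDerivedCategory.standard`)
  — a CONSTRUCTION node (model `Rg_*`), displayed as data `R`; **(L7b) `IsogenyTwistPushforwardIso A g`** — the finite-étale twist
  comparison `α_q : g_*•(K• ⊗ Ω^q) ≅ (g_*•K•) ⊗ Ω^q` (projection formula ∘ `dg`), displayed as data `α`; and the THREE DISPLAYED INPUTS as
  `@[conjecture]` predicates on `(R, α)` (IN-HOUSE, nothing asserted): **(At) `AtiyahClassPushforwardCompat R α`** —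
  `g_{**}(x·ι•·At(E)^q)·[Q α_q] = g_{**}(x)·ι•·At(g_*•E)^q` (the finite-étale twin of (N4)); **(Tr) `TracePushforwardCompat R α`** — an
  injective additive `ρ_q` of the `σ`-target (model: Gysin `g_* = tr ∘ Rg_* ∘ η`, injective as `g^*g_* = Σ_{x ∈ Ker g} τ_x^* = deg g`
  on `H^{p,q}(A)`) with `ρ_q(Q(unit)·Φ_E(y)·Q(Tr•_E)) = Q(unit)·Φ_{g_*E}(g_{**}(y)·[Q α_q])·Q(Tr•_{g_*E})` ((N1) as a comparison MORPHISM,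
  (N2), (N3), (N5) = transitivity of the trace through `g_*𝒪_A`, folded into ONE identity on the tail of `σ_q`);
  **(Ext) `Ext2PushforwardDecomposition R`** — `g_{**}` BIJECTIVE on `Ext²(E•,E•)` given (C^∨) (`Ext²(g_*E,g_*E) ≅ ⊕_x Ext²(τ_x^*E, E)`
  by `g^* ⊣ Rg_*` and the natural form of the THEOREM `IsogenyPullbackPushforwardDecomposition` (p642704), `x ≠ 1` summands killed
  by (C^∨)). Helpers PROVED: `isBoundedVBComplex_of_strictly`, `isBoundedVBComplex_twistHodgeComplex` (`Ω^q_A` finite locally free: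
  `A` smooth of relative dimension `dim A`).
* §4 **`exists_sigmaCompat_of_atiyah_of_trace : (At) → (Tr) → ∀ …, ∃ ρ_q injective, σ_q^{g_*•E}(g_{**} x) = ρ_q(σ_q^E x)`** (the
  finite-étale twin of `mapShiftedHom_sigmaC`, a two-line rewrite through `sigmaC_eq_sigmaTail`) and the composition
  **`isogenyPushforwardISemiregularCTransfer_of : ∀ R α, (At) → (Tr) → (Ext) → IsogenyPushforwardISemiregularCTransfer`** BY NAME (§1 with
  `Ψ = g_{**}`).
* SANITY (PROVED, companion file `VHCAbelianSchemesRoadIsogenyPushforwardISemiregularCTransferDegreeOne.lean`): in degree one (`g_*` an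
  equivalence) the datum EXISTS (Mathlib's `mapDerivedCategory`), its `g_{**}` is the venture's `mapShiftedHom`, the (Ext)-clause holds
  outright, and for `g = 𝟙_A` with `α = twistHodgeComplexPushforwardIso (Iso.refl A.X)` the (At)- and (Tr)-clauses and the `σ`-compatibility
  ARE the landed isomorphism-case transports — for `deg g ≥ 2` the displayed inputs ask exactly the identities that are THEOREMS in degree one.

RESIDUE, BY NAME (stuck goals verbatim): `⊢ IsogenyDerivedDirectImage A g` (data: `Rg_*` on `D(Mod 𝒪_A)` computing `g_*•` on bounded
complexes of vector bundles), `⊢ IsogenyTwistPushforwardIso A g` (data), `⊢ AtiyahClassPushforwardCompat R α`, `⊢ TracePushforwardCompat R α`,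
`⊢ Ext2PushforwardDecomposition R`. (L7a) is also the node core (R) `IsogenyPushforwardExtRankTransfer` needs (`g_{**}` on every `Ext^k`).

References: [cite: BuchweitzFlenner2003, §3 (Atiyah class and trace of a complex), Def. 4.1, §5 (I-semiregular) and Thm. 5.1]
[cite: HuybrechtsLehn1997, §10.1 (10.1.2 trace, 10.1.5 Atiyah class)] [cite: Mukai1978, §3 Prop. 3.12 (p. 249)] [cite: MumfordAV1970, §7
Thm. 1 (p. 66) and Thm. 4 (p. 72)] [cite: GortzWedhorn2023, Def. 20.70 (trace of a finite locally free algebra)] [cite: Hartshorne1977, II §5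
p. 110 (f^* ⊣ f_*), II Ex. 5.1 (d) (projection formula), III.1, III.6, III.8] [cite: Weibel1994, §10.4, Cor. 10.4.7 and §10.5]
[cite: Atiyah1957, §4 Prop. 6–7] [cite: Schlichting2011HigherKTheory, §3.1.3].
-/

noncomputable section

-- `TopCat.Presheaf`/`Scheme.Modules` are not reducible (as in Mathlib's `AlgebraicGeometry/Modules/Sheaf.lean`).
set_option backward.isDefEq.respectTransparency false

open CategoryTheory CategoryTheory.Category CategoryTheory.Limits AlgebraicGeometry Opposite
open DerivedCategory

namespace Summit.HodgeConjecture.HodgeConjecture.Ring2.SemiregularRepresentatives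

set_option linter.dupNamespace false -- the cell's namespace repeats the summit name, as in every `Ring2*` file

open Literature.AlgebraicGeometry Literature.AlgebraicGeometry.Modules Literature.AlgebraicGeometry.Motives
open Literature.AlgebraicGeometry.Motives.AbelianVariety Literature.AlgebraicGeometry.KTheory
open Summit.Ventures.HSemireg Summit.Ventures.HSemireg.HomComplex

/-! ## §3 The derived direct image datum of an isogeny ((L7a)), the finite-étale twist comparison ((L7b)), and the THREE
DISPLAYED INPUTS of core (SC), typed as predicates on these data (in-house; hypotheses wherever used; nothing asserted) -/

section Isogeny

/-- **(L7a) — a DERIVED DIRECT IMAGE DATUM for an endomorphism `g` of a complex abelian variety**: a derived lifting datum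
(§2) for the termwise direct image `g_*• = endoPushforwardComplex A g` on the BOUNDED COMPLEXES OF VECTOR BUNDLES, in the derived
category `D(Mod 𝒪_A)` of ALL `𝒪_A`-modules (`HasDerivedCategory.standard`, the ambient of `HomComplex.sigmaC`, `extRank` and
`OffDiagonalExtVanishing`). Model: `Rg_*` with `Rg_*K• ≅ g_*•K•` (an isogeny is affine, so quasi-coherent terms are `g_*`-acyclic).
WHY A DATUM: for an isogeny of degree `≥ 2` the functor `Scheme.Modules.pushforward g` is NOT right exact on `Mod 𝒪_A` (fibres with
two points: `j_!𝒪_U ↠ k(x₁)`, `U = A ∖ {x₂}`), so Mathlib's `Functor.mapDerivedCategory` — the vehicle of the transport of `σ_q`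
along isomorphisms of schemes (`HomComplexSigmaOfSchemeIso`, pieces (N1)–(N5)) — is not available, and `Rg_*` is not yet
constructible in the tree. A CONSTRUCTION item, not a proposition. [cite: Hartshorne1977, III.8 (higher direct images) and II §5 p. 110]
[cite: MumfordAV1970, §7 Thm. 1 (p. 66): isogenies are finite flat] [cite: Weibel1994, §10.5 (total derived functors)] -/
abbrev IsogenyDerivedDirectImage (A : AbelianVariety ℂ) (g : A ⟶ A) : Type _ :=
  letI := HasDerivedCategory.standard A.X.left.Modules
  DerivedLiftingDatum ((Scheme.Modules.pushforward (Hom.toSchemeHom g)).mapHomologicalComplex (ComplexShape.up ℤ))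
    (fun K : CochainComplex A.X.left.Modules ℤ => IsBoundedVBComplex K)

/-- **(L7b) — the FINITE-ÉTALE TWIST COMPARISON data**: chain isomorphisms `α_q(K•) : g_*•(K• ⊗ Ω^q_A) ≅ (g_*•K•) ⊗ Ω^q_A` for
complexes with finite locally free terms (model: the projection formula `g_*(M ⊗ g^*Ω^q) ≅ g_*M ⊗ Ω^q` composed with
`dg : g^*Ω^q_A ≅ Ω^q_A`, an isomorphism for the étale `g`; for an isomorphism of schemes the venture's
`twistHodgeComplexPushforwardIso`). Data, displayed wherever used. [cite: Hartshorne1977, II Ex. 5.1 (d) (projection formula) and II Prop. 8.10]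
[cite: MumfordAV1970, §7 Thm. 4 (p. 72): isogenies in characteristic 0 are étale] -/
def IsogenyTwistPushforwardIso (A : AbelianVariety ℂ) (g : A ⟶ A) : Type _ :=
  ∀ (q : ℕ) (K : CochainComplex A.X.left.Modules ℤ), (∀ i, IsFiniteLocallyFree (K.X i)) →
    (endoPushforwardComplex A g (twistHodgeComplex A.X q K) ≅ twistHodgeComplex A.X q (endoPushforwardComplex A g K))

/-- A complex concentrated in `[a, b]` with finite locally free terms is a bounded complex of vector bundles. [folklore] -/
theorem isBoundedVBComplex_of_strictly {X : Scheme} (E : CochainComplex X.Modules ℤ) (a b : ℤ) [E.IsStrictlyGE a]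
    [E.IsStrictlyLE b] (hE : ∀ i, IsFiniteLocallyFree (E.X i)) : IsBoundedVBComplex E := by
  refine ⟨hE, Finset.Icc a b, fun i hi => ?_⟩
  rw [Finset.mem_Icc, not_and_or, not_le, not_le] at hi
  rcases hi with hi | hi
  · exact E.isZero_of_isStrictlyGE a i hi
  · exact E.isZero_of_isStrictlyLE b i hi

/-- On a complex abelian variety, `K• ⊗ Ω^q_A` is a bounded complex of vector bundles when `K•` is (`Ω^q_A` is finite locally free:
`A` is smooth of relative dimension `dim A`). [cite: MumfordAV1970, §4 (iii) (p. 42): Ω¹_A is free] [cite: Hartshorne1977, II Ex. 5.16 and II Thm. 8.15] -/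
theorem isBoundedVBComplex_twistHodgeComplex (A : AbelianVariety ℂ) {E : CochainComplex A.X.left.Modules ℤ}
    (hE : IsBoundedVBComplex E) (q : ℕ) : IsBoundedVBComplex (twistHodgeComplex A.X q E) := by
  haveI := A.smoothOfRelativeDimension_dim
  obtain ⟨s, hs⟩ := hE.exists_finset
  exact ⟨fun i => isFiniteLocallyFree_sheafHom_dual (hE.isFiniteLocallyFree i)
      (Literature.AlgebraicGeometry.Crystalline.isFiniteLocallyFree_hodgeSheaf A.X A.dim q),
    s, fun i hi => (twistHodgeFunctor A.X q).map_isZero (hs i hi)⟩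

variable (R : ∀ (A : AbelianVariety ℂ) (g : A ⟶ A), IsIsogeny g → IsogenyDerivedDirectImage A g)
  (α : ∀ (A : AbelianVariety ℂ) (g : A ⟶ A), IsIsogeny g → IsogenyTwistPushforwardIso A g)

/-- **Input (At) — `At(g_*E•) = g_*At(E•)` on the argument of `σ_q`** (`AtiyahClassPushforwardCompat R α`): for every isogeny `g`,
bounded complex of vector bundles `E•` and `x ∈ Ext²(E•, E•)`,
**`g_{**}(x · ι• · At(E•)^q) · [Q α_q] = g_{**}(x) · ι• · At(g_*•E•)^q`** — the finite-étale twin of piece (N4)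
`mapShiftedHom_extMulAtiyahPower_comp` (there for an isomorphism of schemes). Paper: `g` is étale, so `g_*` of the twisted Atiyah ∕ jet
sequences of `E•` are those of `g_*•E•` (`g_*•P^j(E•) ≅ P^j(g_*•E•)`, jets commute with étale base change), `Rg_*` is triangulated, and
`g_{**}` is multiplicative (`DerivedLiftingDatum.mapShiftedHom_comp`). IN-HOUSE; NOT PROVED; a HYPOTHESIS wherever used.
[cite: BuchweitzFlenner2003, §3 (Atiyah class of a complex) and Def. 4.1] [cite: HuybrechtsLehn1997, §10.1 (10.1.5–10.1.6)]
[cite: Atiyah1957, §4 Prop. 6–7] -/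
@[conjecture] def AtiyahClassPushforwardCompat : Prop :=
  ∀ (A : AbelianVariety ℂ) (g : A ⟶ A) (hg : IsIsogeny g) (E : CochainComplex A.X.left.Modules ℤ) (hE : IsBoundedVBComplex E)
    (q : ℕ),
    letI := HasDerivedCategory.standard A.X.left.Modules
    ∀ x : ShiftedHom (Q.obj E) (Q.obj E) (2 : ℤ),
      ((R A g hg).mapShiftedHom hE (isBoundedVBComplex_twistHodgeComplex A hE q) (extMulAtiyahPower A.X E q x)).comp
          (ShiftedHom.mk₀ (0 : ℤ) rfl (Q.map (α A g hg q E hE.isFiniteLocallyFree).hom)) (zero_add _) =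
        extMulAtiyahPower A.X (endoPushforwardComplex A g E) q ((R A g hg).mapShiftedHom hE hE x)

/-- **Input (Tr) — the trace side: `Tr•` is transitive through the finite locally free algebra `g_*𝒪_A`, and the resulting map on
`H^{q+2}(A, Ω^q)` is injective** (`TracePushforwardCompat R α`): for every isogeny `g`, complex `E•` in `[a, b]` with vector-bundle
terms (and `g_*•E•` termwise a vector bundle) and every `q`, there is an INJECTIVE additive map `ρ_q` of the `σ`-target
`Hom_D(Q 𝒪_A[0], (Q Ω^q_A[0])⟦q+2⟧) = H^{q+2}(A, Ω^q_A)` (model: the Gysin ∕ trace map `g_* = tr_{g_*𝒪/𝒪} ∘ Rg_* ∘ η`; injective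
because `g^*g_* = Σ_{x ∈ Ker g} τ_x^* = deg g` on `H^{p,q}(A)`, translations acting trivially) such that for every
`y : Q E• ⟶ (Q (E• ⊗ Ω^q))⟦q+2⟧`: **`ρ_q(Q(unit) · Φ_E(y) · Q(Tr•_E)) = Q(unit) · Φ_{g_*E}(g_{**}(y) · [Q α_q]) · Q(Tr•_{g_*E})`** —
pieces (N1) (`g_*` on `𝓗om•`, here only a comparison morphism), (N2) (unit), (N3) (descent base change) and (N5) (supertrace) of the
isomorphism case folded into ONE identity on the tail of `σ_q`. IN-HOUSE; NOT PROVED; a HYPOTHESIS wherever used.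
[cite: BuchweitzFlenner2003, §3 (trace) and Def. 4.1] [cite: GortzWedhorn2023, Def. 20.70 (trace of a finite locally free algebra)]
[cite: MumfordAV1970, §7 Thm. 4 (p. 72)] [cite: HuybrechtsLehn1997, §10.1 (trace map)] -/
@[conjecture] def TracePushforwardCompat : Prop :=
  ∀ (A : AbelianVariety ℂ) (g : A ⟶ A) (hg : IsIsogeny g) (E : CochainComplex A.X.left.Modules ℤ) (a b : ℤ)
    [E.IsStrictlyGE a] [E.IsStrictlyLE b] (hE : ∀ i, IsFiniteLocallyFree (E.X i))
    (hE' : ∀ i, IsFiniteLocallyFree ((endoPushforwardComplex A g E).X i)) (q : ℕ),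
    letI := HasDerivedCategory.standard A.X.left.Modules
    ∃ ρ : sigmaTarget A.X q →+ sigmaTarget A.X q, Function.Injective ρ ∧
      ∀ y : ShiftedHom (Q.obj E) (Q.obj (twistHodgeComplex A.X q E)) ((q : ℤ) + 2),
        ρ (sigmaTail A.X E a b hE q y) =
          sigmaTail A.X (endoPushforwardComplex A g E) a b hE' q
            (((R A g hg).mapShiftedHom (isBoundedVBComplex_of_strictly E a b hE)
                (isBoundedVBComplex_twistHodgeComplex A (isBoundedVBComplex_of_strictly E a b hE) q) y).comp
              (ShiftedHom.mk₀ (0 : ℤ) rfl (Q.map (α A g hg q E hE).hom)) (zero_add _))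

/-- **Input (Ext) — the `Ext²` decomposition reduced to its `x = 0` summand by (C^∨)** (`Ext2PushforwardDecomposition R`): for every
isogeny `g` and bounded complex of vector bundles `E•` satisfying (C^∨) for `(g, E•)`,
**`g_{**} : Ext²(E•, E•) → Ext²(g_*•E•, g_*•E•)` is BIJECTIVE** (model: `Ext²(g_*E, g_*E) ≅ Ext²(g^*g_*E, E) ≅ ⊕_{x ∈ Ker g(ℂ)} Ext²(τ_x^*E, E)`
by `g^* ⊣ Rg_*` and the natural decomposition `g^*g_*E• ≅ ⊕_x τ_x^*E•` — the Literature named fact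
`IsogenyPullbackPushforwardDecomposition`, THEOREM p642704, in its derived form — whose `x ≠ 1` summands vanish by (C^∨) and whose
`x = 1` summand is `g_{**}`). The finite-étale replacement of `mapShiftedHom_bijective` (there for an equivalence). IN-HOUSE; NOT
PROVED; a HYPOTHESIS wherever used. [cite: Mukai1978, §3 Prop. 3.12 (p. 249)] [cite: MumfordAV1970, §7 Thm. 4 (p. 72)]
[cite: Hartshorne1977, II §5 p. 110 (f^* ⊣ f_*) and III.6] -/
@[conjecture] def Ext2PushforwardDecomposition : Prop :=
  ∀ (A : AbelianVariety ℂ) (g : A ⟶ A) (hg : IsIsogeny g) (E : CochainComplex A.X.left.Modules ℤ) (hE : IsBoundedVBComplex E),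
    OffDiagonalExtVanishing A g E →
      letI := HasDerivedCategory.standard A.X.left.Modules
      Function.Bijective ((R A g hg).mapShiftedHom hE hE :
        ShiftedHom (Q.obj E) (Q.obj E) (2 : ℤ) →
          ShiftedHom (Q.obj (endoPushforwardComplex A g E)) (Q.obj (endoPushforwardComplex A g E)) (2 : ℤ))

/-! ## §4 Core (SC) as a kernel composition of (At), (Tr), (Ext) over the data (L7a), (L7b) -/

/-- **`σ`-COMPATIBILITY of `g_{**}` from (At) and (Tr)**: for every `q` there is an injective `ρ_q` on the `σ`-target with
`σ_q^{g_*•E}(g_{**} x) = ρ_q(σ_q^{E}(x))` for all `x ∈ Ext²(E•, E•)` — `σ_q = sigmaTail ∘ (· · ι• · At^q)` definitionally, (At) moves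
the Atiyah part across `g_{**}` up to `[Q α_q]`, (Tr) moves the tail. The finite-étale twin of `mapShiftedHom_sigmaC`.
[cite: BuchweitzFlenner2003, Def. 4.1 and §3] -/
theorem exists_sigmaCompat_of_atiyah_of_trace (hAt : AtiyahClassPushforwardCompat R α) (hTr : TracePushforwardCompat R α)
    (A : AbelianVariety ℂ) (g : A ⟶ A) (hg : IsIsogeny g) (E : CochainComplex A.X.left.Modules ℤ) (a b : ℤ)
    [E.IsStrictlyGE a] [E.IsStrictlyLE b] (hE : ∀ i, IsFiniteLocallyFree (E.X i))
    (hE' : ∀ i, IsFiniteLocallyFree ((endoPushforwardComplex A g E).X i)) (q : ℕ) :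
    letI := HasDerivedCategory.standard A.X.left.Modules
    ∃ ρ : sigmaTarget A.X q →+ sigmaTarget A.X q, Function.Injective ρ ∧
      ∀ x : ShiftedHom (Q.obj E) (Q.obj E) (2 : ℤ),
        sigmaC A.X (endoPushforwardComplex A g E) a b hE' q
            ((R A g hg).mapShiftedHom (isBoundedVBComplex_of_strictly E a b hE) (isBoundedVBComplex_of_strictly E a b hE) x) =
          ρ (sigmaC A.X E a b hE q x) := by
  letI := HasDerivedCategory.standard A.X.left.Modules
  have hEb : IsBoundedVBComplex E := isBoundedVBComplex_of_strictly E a b hE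
  obtain ⟨ρ, hρ, hy⟩ := hTr A g hg E a b hE hE' q
  refine ⟨ρ, hρ, fun x => ?_⟩
  rw [sigmaC_eq_sigmaTail, sigmaC_eq_sigmaTail, hy, hAt A g hg E hEb q x]

/-- **Core (SC) `IsogenyPushforwardISemiregularCTransfer` of THEOREM T — stub (c1) of skeleton v3.9 on crux stmt-HodgeConjecture-26512 via
`isogenyPushforwardAdmissibilityTransferPrime_of_cores` — CLOSED IN KERNEL MODULO exactly: the construction (L7a) `R` (a derived direct
image datum for every isogeny), the data (L7b) `α` (finite-étale twist comparison), and the three displayed compatibilities (At)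
`AtiyahClassPushforwardCompat R α`, (Tr) `TracePushforwardCompat R α`, (Ext) `Ext2PushforwardDecomposition R`.** Proof: the abstract
transfer of §1 with `Ψ = g_{**}` on `Ext²` (bijective by (Ext), given (C^∨)) and the injective `ρ_q` of the `σ`-compatibility
(`exists_sigmaCompat_of_atiyah_of_trace`). CONDITIONAL (the inputs are displayed); nothing else assumed; closes no stub; HC_CM untouched.
[cite: BuchweitzFlenner2003, §3, Def. 4.1 and §5 (I-semiregular)] [cite: Mukai1978, §3 Prop. 3.12 (p. 249)]
[cite: GortzWedhorn2023, Def. 20.70] [cite: MumfordAV1970, §7 Thm. 4 (p. 72)] -/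
theorem isogenyPushforwardISemiregularCTransfer_of (hAt : AtiyahClassPushforwardCompat R α)
    (hTr : TracePushforwardCompat R α) (hExt : Ext2PushforwardDecomposition R) :
    IsogenyPushforwardISemiregularCTransfer := by
  intro A g hg E a b _ _ hE hE' hC J
  letI := HasDerivedCategory.standard A.X.left.Modules
  have hEb : IsBoundedVBComplex E := isBoundedVBComplex_of_strictly E a b hE
  have key := fun q => exists_sigmaCompat_of_atiyah_of_trace R α hAt hTr A g hg E a b hE hE' q
  exact isISemiregularC_iff_of_sigmaCompat
    ((R A g hg).mapShiftedHom hEb hEb) (fun q => (key q).choose)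
    (fun q _ x => ((key q).choose_spec.2 x)) (hExt A g hg E hEb hC) (fun q _ => (key q).choose_spec.1)

end Isogeny

end Summit.HodgeConjecture.HodgeConjecture.Ring2.SemiregularRepresentatives

end
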